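import Mathlib.FieldTheory.Finite.GaloisField
import Mathlib.RingTheory.PowerSeries.Inverse
import Mathlib.RingTheory.PowerSeries.Order
import Mathlib.RingTheory.KrullDimension.LocalRing
import Mathlib.RingTheory.Regular.RegularSequence
import Literature.RingTheory.TightClosure.TightClosure

/-!
# `FRationalModification` — negative lemmas II(a): the witness rings `K + X·L⟦X⟧`

Support (negative) lemmas for crux `stmt-ResolutionOfSingularities-15316`
(`Summit.ResolutionOfSingularities.ResolutionOfSingularities.Theses.FrobeniusLadder.FRationalModification`,
route FrobeniusLadder, rank 3), filed by the standing disprover (cdisprove gen 1, cycle 1; work file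
`Cruxes/FRationalModification/Disproof.lean`, §3). This file sets up the witness rings for the companion
file `Negative/RungTwoNotRungThree.lean`, where the natural strengthening "the rung-2 model is already
rung-3" of the crux is refuted at every prime. No definition and no notation is declared: throughout,
`L` is a field, `K` a subfield, and `R` a subring of `L⟦X⟧` together with the hypothesis
`hR : f ∈ R ↔ f(0) ∈ K`, i.e. `R = K + X·L⟦X⟧` (for `L = 𝔽₉`, `K = 𝔽₃` this is the completed local ring
of the integral plane curve `x² + y² = 0` over `𝔽₃` at the origin — an F-pure, non-normal point that
becomes a node over `𝔽₉`).

* `isUnit_iff_constantCoeff`, `isLocalRing_of_mem_iff`: `R` is local, units = nonzero constant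
  coefficient; `charP_of_mem_iff`: `char R = char L`;
* `module_finite_powerSeries` (`L⟦X⟧` is module-finite over `K⟦X⟧` when `[L : K] < ∞`, coefficientwise
  expansion in a basis) and `isNoetherianRing_of_mem_iff`: `R` is Noetherian;
* `mem_radical_of_constantCoeff_eq_zero` (`𝔪 ⊆ rad (a)` for `a ≠ 0`: `g = X g'` has
  `g^(n+1) = a·(u⁻¹ X g'^(n+1))` where `a = Xⁿu`), hence `ringKrullDim_of_mem_iff : dim R = 1` and
  `isMaximal_radical_span_X` (`(X)` is a parameter ideal);
* `dvd_of_pow_eq_mul_pow`: in `L⟦X⟧`, `y^q = r a^q`, `a ≠ 0`, `q > 0 ⇒ a ∣ y` (compare orders);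
* `mem_fieldRange_of_pow_mem`: the prime field is Frobenius-saturated in any field of characteristic
  `p` (`x^(p^e) ∈ 𝔽_p ⇒ x ∈ 𝔽_p`, by counting roots of `T^p − T`); `exists_not_mem_fieldRange`:
  `𝔽_{p²} ≠ 𝔽_p`.

## Sources
* R. Fedder, K.-i. Watanabe, MSRI Publ. 15 (1989), Def. 1.5 / 1.10 (Frobenius closure, F-rational; tree
  vocabulary `Literature/RingTheory/TightClosure`). The rings `K + X·L⟦X⟧` are folklore (seminormal,
  non-normal one-dimensional local domains with a residue field extension in the normalisation).
-/

noncomputable section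

open IsLocalRing

-- single-problem summit: the doubled namespace component `ResolutionOfSingularities` is forced
set_option linter.dupNamespace false

namespace Summit.ResolutionOfSingularities.ResolutionOfSingularities.Theorems.FRationalModification.Negative

/-! ## The prime field inside a field of characteristic `p` -/

section PrimeField

variable (p : ℕ) [Fact p.Prime] (L : Type) [Field L] [CharP L p]

/-- An element of a field of characteristic `p` fixed by Frobenius lies in the prime field (the
`p` elements of `𝔽_p` are already `p` roots of `T^p − T`). [folklore] -/
theorem mem_fieldRange_of_pow_eq {x : L} (hx : x ^ p = x) :
    x ∈ (ZMod.castHom (dvd_refl p) L).fieldRange := by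
  classical
  have hp : 1 < p := (Fact.out : p.Prime).one_lt
  by_contra hxn
  set f : Polynomial L := Polynomial.X ^ p - Polynomial.X with hf
  have hf0 : f ≠ 0 := FiniteField.X_pow_card_sub_X_ne_zero L hp
  have hdeg : f.natDegree = p := FiniteField.X_pow_card_sub_X_natDegree_eq L hp
  let S : Finset L := insert x (Finset.univ.image (ZMod.castHom (dvd_refl p) L))
  have hS : S ⊆ f.roots.toFinset := by
    intro y hy
    rw [Multiset.mem_toFinset, Polynomial.mem_roots hf0, Polynomial.IsRoot, hf, Polynomial.eval_sub,
      Polynomial.eval_pow, Polynomial.eval_X, sub_eq_zero]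
    rcases Finset.mem_insert.mp hy with rfl | hy
    · exact hx
    · obtain ⟨b, -, rfl⟩ := Finset.mem_image.mp hy
      rw [← map_pow, ZMod.pow_card]
  have hxS : x ∉ Finset.univ.image (ZMod.castHom (dvd_refl p) L) := by
    intro hx'
    obtain ⟨b, -, hb⟩ := Finset.mem_image.mp hx'
    exact hxn ((ZMod.castHom (dvd_refl p) L).mem_fieldRange.mpr ⟨b, hb⟩)
  have hcardS : S.card = p + 1 := by
    rw [Finset.card_insert_of_notMem hxS,
      Finset.card_image_of_injective _ (ZMod.castHom (dvd_refl p) L).injective, Finset.card_univ, ZMod.card]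
  have := (Finset.card_le_card hS).trans ((Multiset.toFinset_card_le _).trans (Polynomial.card_roots' f))
  rw [hcardS, hdeg] at this
  omega

/-- **The prime field is Frobenius-saturated**: `x^(p^e) ∈ 𝔽_p ⇒ x ∈ 𝔽_p`. [folklore] -/
theorem mem_fieldRange_of_pow_mem {x : L} (e : ℕ) (hx : x ^ p ^ e ∈ (ZMod.castHom (dvd_refl p) L).fieldRange) :
    x ∈ (ZMod.castHom (dvd_refl p) L).fieldRange := by
  apply mem_fieldRange_of_pow_eq
  obtain ⟨b, hb⟩ := (ZMod.castHom (dvd_refl p) L).mem_fieldRange.mp hx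
  have h1 : (x ^ p ^ e) ^ p = x ^ p ^ e := by rw [← hb, ← map_pow, ZMod.pow_card]
  have h2 : (x ^ p - x) ^ p ^ e = 0 := by
    rw [sub_pow_char_pow, pow_right_comm, h1, sub_self]
  exact sub_eq_zero.mp ((pow_eq_zero_iff (pow_ne_zero e (Fact.out : p.Prime).ne_zero)).mp h2)

/-- `𝔽_{p²} ≠ 𝔽_p`. [folklore] -/
theorem exists_not_mem_fieldRange :
    ∃ ω : GaloisField p 2, ω ∉ (ZMod.castHom (dvd_refl p) (GaloisField p 2)).fieldRange := by
  by_contra h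
  have h' : ∀ ω : GaloisField p 2, ω ∈ (ZMod.castHom (dvd_refl p) (GaloisField p 2)).fieldRange :=
    fun ω => not_not.mp (not_exists.mp h ω)
  have hsurj : Function.Surjective (ZMod.castHom (dvd_refl p) (GaloisField p 2)) := fun y =>
    (ZMod.castHom (dvd_refl p) (GaloisField p 2)).mem_fieldRange.mp (h' y)
  have h1 := Nat.card_le_card_of_surjective _ hsurj
  rw [GaloisField.card p 2 two_ne_zero, Nat.card_zmod] at h1
  have hp := (Fact.out : p.Prime).two_le
  nlinarith

end PrimeField

/-! ## The rings `R = K + X·L⟦X⟧` -/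

section Witness

variable {L : Type} [Field L] (K : Subfield L) (R : Subring (PowerSeries L))
  (hR : ∀ f : PowerSeries L, f ∈ R ↔ PowerSeries.constantCoeff f ∈ K)
include hR

/-- `X ∈ R`. [folklore] -/
theorem X_mem : (PowerSeries.X : PowerSeries L) ∈ R := by
  rw [hR, PowerSeries.constantCoeff_X]; exact K.zero_mem

/-- Units of `R` are the series with nonzero constant coefficient (the inverse of such a series has
constant coefficient in the subFIELD `K`). [folklore] -/
theorem isUnit_iff_constantCoeff (a : R) :
    IsUnit a ↔ PowerSeries.constantCoeff (a : PowerSeries L) ≠ 0 := by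
  constructor
  · intro h h0
    have h1 := h.map R.subtype
    rw [PowerSeries.isUnit_iff_constantCoeff] at h1
    exact h1.ne_zero h0
  · intro h
    have hu : IsUnit (a : PowerSeries L) :=
      PowerSeries.isUnit_iff_constantCoeff.mpr (isUnit_iff_ne_zero.mpr h)
    have hinv : (↑hu.unit⁻¹ : PowerSeries L) ∈ R := by
      rw [hR]
      have h1 : PowerSeries.constantCoeff (a : PowerSeries L) *
          PowerSeries.constantCoeff (↑hu.unit⁻¹ : PowerSeries L) = 1 := by
        rw [← map_mul, hu.mul_val_inv, map_one]
      rw [eq_inv_of_mul_eq_one_right h1]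
      exact K.inv_mem ((hR a).mp a.2)
    exact isUnit_iff_exists_inv.mpr ⟨⟨_, hinv⟩, Subtype.ext hu.mul_val_inv⟩

/-- `X` is not a unit of `R`. [folklore] -/
theorem not_isUnit_X : ¬ IsUnit (⟨PowerSeries.X, X_mem K R hR⟩ : R) := by
  rw [isUnit_iff_constantCoeff K R hR]; simp

/-- `R` is local. [folklore] -/
theorem isLocalRing_of_mem_iff : IsLocalRing R := by
  refine IsLocalRing.of_isUnit_or_isUnit_one_sub_self fun a => ?_
  by_cases h : PowerSeries.constantCoeff (a : PowerSeries L) = 0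
  · right
    rw [isUnit_iff_constantCoeff K R hR]
    simp [h]
  · exact Or.inl ((isUnit_iff_constantCoeff K R hR a).mpr h)

omit hR in
/-- A subring of `L⟦X⟧` has the characteristic of `L`. [folklore] -/
theorem charP_of_mem_iff (p : ℕ) [CharP L p] : CharP R p := by
  refine ⟨fun n => ⟨fun h => ?_, fun h => ?_⟩⟩
  · have h1 := congrArg (fun r : R => PowerSeries.constantCoeff (r : PowerSeries L)) h
    simp only [Subring.coe_natCast, map_natCast, ZeroMemClass.coe_zero, map_zero] at h1
    exact (CharP.cast_eq_zero_iff L p n).mp h1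
  · apply Subtype.ext
    rw [Subring.coe_natCast, ZeroMemClass.coe_zero, ← map_natCast (PowerSeries.C (R := L)) n,
      (CharP.cast_eq_zero_iff L p n).mpr h, map_zero]

omit hR in
/-- `L⟦X⟧` is a finite `K⟦X⟧`-module when `[L : K] < ∞` (coefficientwise expansion in a basis).
[folklore] -/
theorem module_finite_powerSeries [Module.Finite K L] :
    Module.Finite (PowerSeries K) (PowerSeries L) := by
  classical
  let b := Module.finBasis K L
  refine ⟨⟨Finset.univ.image (fun i => PowerSeries.C (b i)), ?_⟩⟩
  rw [eq_top_iff]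
  rintro f -
  set g : Fin (Module.finrank K L) → PowerSeries K :=
    fun i => PowerSeries.mk fun m => b.repr (PowerSeries.coeff m f) i with hg
  have hf : f = ∑ i, g i • PowerSeries.C (b i) := by
    ext m
    rw [map_sum]
    have key : ∀ i, PowerSeries.coeff m (g i • PowerSeries.C (b i)) =
        (b.repr (PowerSeries.coeff m f) i) • b i := fun i => by
      change PowerSeries.coeff m (PowerSeries.map (algebraMap K L) (g i) * PowerSeries.C (b i)) = _
      rw [PowerSeries.coeff_mul_C, PowerSeries.coeff_map, hg, PowerSeries.coeff_mk, Algebra.smul_def]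
    rw [Finset.sum_congr rfl fun i _ => key i, b.sum_repr]
  rw [hf]
  refine Submodule.sum_mem _ fun i _ => Submodule.smul_mem _ _ (Submodule.subset_span ?_)
  simp

/-- `R` is Noetherian when `[L : K] < ∞`: it is a `K⟦X⟧`-submodule of the finite `K⟦X⟧`-module
`L⟦X⟧`. [folklore] -/
theorem isNoetherianRing_of_mem_iff [Module.Finite K L] : IsNoetherianRing R := by
  haveI := module_finite_powerSeries K
  let ψ : PowerSeries K →+* R :=
    (algebraMap (PowerSeries K) (PowerSeries L)).codRestrict R (fun a => by
      rw [hR]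
      change PowerSeries.constantCoeff (PowerSeries.map (algebraMap K L) a) ∈ K
      rw [← PowerSeries.coeff_zero_eq_constantCoeff_apply, PowerSeries.coeff_map]
      exact SetLike.coe_mem _)
  letI : Algebra (PowerSeries K) R := ψ.toAlgebra
  let ι : R →ₗ[PowerSeries K] PowerSeries L :=
    { toFun := fun w => (w : PowerSeries L)
      map_add' := fun _ _ => rfl
      map_smul' := fun _ _ => rfl }
  have hN : IsNoetherian (PowerSeries K) R := isNoetherian_of_injective ι Subtype.val_injective
  exact isNoetherian_of_tower (PowerSeries K) hN

/-- `R` is not a field (`X` is a nonzero non-unit). [folklore] -/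
theorem not_isField : ¬ IsField R := fun h => by
  letI := h.toField
  exact not_isUnit_X K R hR (isUnit_iff_ne_zero.mpr fun h0 => PowerSeries.X_ne_zero (congrArg Subtype.val h0))

omit hR in
/-- In `L⟦X⟧` a nonzero series is `X^(ord)` times a unit. [folklore] -/
theorem isUnit_divXPowOrder {a : PowerSeries L} (ha : a ≠ 0) : IsUnit (PowerSeries.divXPowOrder a) := by
  obtain ⟨n, hn⟩ : ∃ n : ℕ, a.order = n := ⟨_, (ENat.coe_toNat (PowerSeries.order_eq_top.not.mpr ha)).symm⟩
  rw [PowerSeries.isUnit_iff_constantCoeff, PowerSeries.constantCoeff_divXPowOrder, isUnit_iff_ne_zero,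
    hn, ENat.toNat_coe]
  exact (PowerSeries.order_eq_nat.mp hn).1

/-- The key estimate `𝔪 ⊆ rad (a)` for every `a ≠ 0`: a non-unit `g = X·g'` has
`g^(n+1) = a · (u⁻¹ X g'^(n+1))` where `a = Xⁿ u`. [folklore] -/
theorem mem_radical_of_constantCoeff_eq_zero {a : R} (ha : a ≠ 0) {g : R}
    (hg : PowerSeries.constantCoeff (g : PowerSeries L) = 0) : g ∈ (Ideal.span {a}).radical := by
  have ha' : (a : PowerSeries L) ≠ 0 := fun h => ha (Subtype.ext h)
  set n := (a : PowerSeries L).order.toNat with hn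
  have hau : PowerSeries.X ^ n * PowerSeries.divXPowOrder (a : PowerSeries L) = (a : PowerSeries L) :=
    PowerSeries.X_pow_order_mul_divXPowOrder
  obtain ⟨u, hu⟩ := isUnit_divXPowOrder ha'
  obtain ⟨g', hg'⟩ := PowerSeries.X_dvd_iff.mpr hg
  rw [Ideal.mem_radical_iff]
  set ui : PowerSeries L := ((u⁻¹ : (PowerSeries L)ˣ) : PowerSeries L) with hui
  have huu : ui * (u : PowerSeries L) = 1 := by rw [hui, Units.inv_mul]
  refine ⟨n + 1, Ideal.mem_span_singleton'.mpr ⟨⟨ui * PowerSeries.X * g' ^ (n + 1), ?_⟩, ?_⟩⟩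
  · rw [hR]; simp
  · apply Subtype.ext
    show (ui * PowerSeries.X * g' ^ (n + 1)) * (a : PowerSeries L) = (g : PowerSeries L) ^ (n + 1)
    rw [hg', ← hau, ← hu, mul_pow, pow_succ]
    calc ui * PowerSeries.X * g' ^ (n + 1) * (PowerSeries.X ^ n * ↑u)
        = (ui * ↑u) * (PowerSeries.X ^ n * PowerSeries.X) * g' ^ (n + 1) := by ring
      _ = PowerSeries.X ^ n * PowerSeries.X * g' ^ (n + 1) := by rw [huu, one_mul]

/-- `dim R = 1`. [folklore] -/
theorem ringKrullDim_of_mem_iff : ringKrullDim R = 1 := by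
  haveI := isLocalRing_of_mem_iff K R hR
  refine ringKrullDim_eq_one_iff_of_isLocalRing_isDomain.mpr ⟨not_isField K R hR, fun a ha g hg => ?_⟩
  refine mem_radical_of_constantCoeff_eq_zero K R hR ha (not_not.mp fun h0 => ?_)
  exact (mem_nonunits_iff.mp ((IsLocalRing.mem_maximalIdeal g).mp hg))
    ((isUnit_iff_constantCoeff K R hR g).mpr h0)

/-- `(X)` is a parameter ideal of `R`: its radical is the maximal ideal. [folklore] -/
theorem isMaximal_radical_span_X :
    (Ideal.span {(⟨PowerSeries.X, X_mem K R hR⟩ : R)}).radical.IsMaximal := by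
  haveI := isLocalRing_of_mem_iff K R hR
  have h : (Ideal.span {(⟨PowerSeries.X, X_mem K R hR⟩ : R)}).radical = maximalIdeal R := by
    refine le_antisymm (IsLocalRing.le_maximalIdeal ?_) fun g hg => ?_
    · rw [Ne, Ideal.radical_eq_top, Ideal.span_singleton_eq_top]; exact not_isUnit_X K R hR
    · refine mem_radical_of_constantCoeff_eq_zero K R hR
        (fun h0 => PowerSeries.X_ne_zero (congrArg Subtype.val h0)) (not_not.mp fun h0 => ?_)
      exact (mem_nonunits_iff.mp ((IsLocalRing.mem_maximalIdeal g).mp hg))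
        ((isUnit_iff_constantCoeff K R hR g).mpr h0)
  rw [h]
  exact maximalIdeal.isMaximal _

omit hR in
/-- In `L⟦X⟧`: `y^q = r a^q` with `a ≠ 0`, `q > 0` forces `a ∣ y` (compare orders). [folklore] -/
theorem dvd_of_pow_eq_mul_pow {a y r : PowerSeries L} (ha : a ≠ 0) {q : ℕ} (hq : 0 < q)
    (h : y ^ q = r * a ^ q) : a ∣ y := by
  by_cases hy : y = 0
  · exact hy ▸ dvd_zero a
  obtain ⟨na, hna⟩ : ∃ n : ℕ, a.order = n := ⟨_, (ENat.coe_toNat (PowerSeries.order_eq_top.not.mpr ha)).symm⟩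
  obtain ⟨ny, hny⟩ : ∃ n : ℕ, y.order = n := ⟨_, (ENat.coe_toNat (PowerSeries.order_eq_top.not.mpr hy)).symm⟩
  have hle : na ≤ ny := by
    have h1 : (y ^ q).order = q • (ny : ℕ∞) := by rw [PowerSeries.order_pow, hny]
    have h2 : (y ^ q).order = r.order + q • (na : ℕ∞) := by
      rw [h, PowerSeries.order_mul, PowerSeries.order_pow, hna]
    have h3 : q • (na : ℕ∞) ≤ q • (ny : ℕ∞) := by rw [← h1, h2]; exact le_add_self
    have h4 : ((q * na : ℕ) : ℕ∞) ≤ ((q * ny : ℕ) : ℕ∞) := by simpa [nsmul_eq_mul] using h3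
    exact Nat.le_of_mul_le_mul_left (ENat.coe_le_coe.mp h4) hq
  have hXy : PowerSeries.X ^ na ∣ y := by
    have := PowerSeries.X_pow_order_dvd (φ := y)
    rw [hny, ENat.toNat_coe] at this
    exact (pow_dvd_pow _ hle).trans this
  have hau : PowerSeries.X ^ na * PowerSeries.divXPowOrder a = a := by
    have := PowerSeries.X_pow_order_mul_divXPowOrder (f := a)
    rwa [hna, ENat.toNat_coe] at this
  obtain ⟨u, hu⟩ := isUnit_divXPowOrder ha
  obtain ⟨y', hy'⟩ := hXy
  set ui : PowerSeries L := ((u⁻¹ : (PowerSeries L)ˣ) : PowerSeries L) with hui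
  have huu : (u : PowerSeries L) * ui = 1 := by rw [hui, Units.mul_inv]
  refine ⟨ui * y', ?_⟩
  rw [hy', ← hau, ← hu]
  calc PowerSeries.X ^ na * y' = PowerSeries.X ^ na * ((u : PowerSeries L) * ui) * y' := by
        rw [huu, mul_one]
    _ = PowerSeries.X ^ na * ↑u * (ui * y') := by ring

end Witness

end Summit.ResolutionOfSingularities.ResolutionOfSingularities.Theorems.FRationalModification.Negative
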